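import Literature.Computability.Cryptography.Indistinguishability
import Literature.Computability.QuantumComplexity.Forrelation
import HarnessLib
import HarnessLib.Audit

/-!
# Indistinguishability obfuscation (iO) for Boolean circuits

Topic `Literature/Computability/Cryptography` (definition item
`defn-IndistinguishabilityObfuscator`; wanted by route `QuantumAdvantage/HiddenSpread`, crux
`ObfuscatedSpreadInstantiation`).

An *obfuscator* is a probabilistic algorithm `O` that rewrites a Boolean circuit `C` into a circuit
`O(C)` computing the same function (Barak–Goldreich–Impagliazzo–Rudich–Sahai–Vadhan–Yang, Def. 2.2:
"(functionality) for every circuit `C`, the string `O(C)` describes a circuit that computes the same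
function as `C`; (polynomial slowdown) there is a polynomial `p` such that `|O(C)| ≤ p(|C|)`").
An *indistinguishability obfuscator* (ibid., Def. 7.1) replaces the (impossible) "virtual black
box" requirement by: "for any PPT `A` there is a negligible `α` such that for any two circuits
`C₁, C₂` that compute the same function and are of the same size `k`,
`|Pr[A(O(C₁)) = 1] − Pr[A(O(C₂)) = 1]| ≤ α(k)`". Garg–Gentry–Halevi–Raykova–Sahai–Waters (2013,
Def. 1) restate the notion with an explicit security parameter `λ` for a circuit class `{𝒞_λ}`:
a uniform PPT machine `iO(λ, C)` with (i) `Pr[C'(x) = C(x) : C' ← iO(λ, C)] = 1` for all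
`C ∈ 𝒞_λ` and all inputs `x`, and (ii) for every (not necessarily uniform) PPT distinguisher `D` a
negligible `α` with `|Pr[D(iO(λ, C₀)) = 1] − Pr[D(iO(λ, C₁)) = 1]| ≤ α(λ)` for all `λ` and all
functionally equivalent `C₀, C₁ ∈ 𝒞_λ` (of the same size); Def. 2 (iO *for `P/poly`*) takes
`𝒞_λ =` all circuits of size at most `λ`.

## Contents

* `SizedCircuit = Σ n, Circuit (Fin n)` (tree circuits, `Complexity/Circuit.lean`) and its
  injective Boolean code `encodeSizedCircuit ⟨n, C⟩ = ⟨bin n, encodeCircuit C⟩`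
  (`encodeCircuit` of `QuantumComplexity/Forrelation.lean`); circuit classes are
  `𝒞 : ℕ → Set SizedCircuit` indexed by the security parameter; `sizeBoundedCircuits s` (the
  `B₂`-circuits with `n + #gates ≤ s κ`) and `ppolyCircuits = sizeBoundedCircuits id` (GGHRSW
  Def. 2).
* `CircuitObfuscator`: the bare syntax `obf κ C r` (security parameter `κ` — the papers' `λ` —,
  circuit, coins ↦ circuit on the same inputs) with its coin budget; `toRandAlg`, `coins`,
  the obfuscation law `obfPMF κ C : PMF (Circuit (Fin n))` and its coded form `obfCodePMF`.
* The four requirements as separate predicates: `IsEfficient` (uniform PPT, via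
  `RandAlg.IsPolyTime`), `PreservesFunctionality 𝒞` (PERFECT: every circuit in the support of
  `iO(κ, C)` is a `B₂`-circuit computing `C.eval`), `HasPolySlowdown 𝒞`, and security
  `IsIndistinguishable 𝒞` (uniform PPT distinguishers, the tree's `IsPPT D encodeBool`, exactly the
  adversary class of `IsCompIndistinguishable`) / `IsIndistinguishableNonuniform 𝒞` (PPT with
  polynomial advice, as `IsCompIndistinguishableNonuniform`); the advantages `ioAdvantage`,
  `ioAdvantageAdv` are those of `Indistinguishability.lean` (`acceptPMF`, input `(1^κ, code)`).
* `IsIO 𝒞 O` / `IsIONonuniform 𝒞 O` bundle them; `IndistinguishabilityObfuscator 𝒞` is the bundled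
  structure (an obfuscator together with `IsIO`); `IOExist` ("iO for `P/poly` exists") is a
  separate `Prop`, never asserted.
* API: `mem_support_obfPMF_iff`, `preservesFunctionality_iff` (coin-wise form
  `∀ r, |r| = coins → (obf κ C r).eval = C.eval`), `PreservesFunctionality.eval_obf`,
  `ioAdvantage_eq_distAdvantage`, bounds, antitonicity in the class, and
  `IsIndistinguishable.isCompIndistinguishable`: obfuscations of two sequences of same-size
  equivalent circuits of the class are computationally indistinguishable ensembles
  (tree `IsCompIndistinguishable`).

## Design choices

* Circuits are the tree's single-output straight-line programs `Circuit (Fin n)`; "circuit" in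
  BGI+ means "a standard boolean circuit with AND, OR and NOT gates" (§2.1), here rendered by the
  basis `B₂` (fan-in `≤ 2`, the basis of the tree's explicit-circuit problems, e.g.
  `KForrelationInstance`); the classes below consist of `B₂`-circuits and functionality asks the
  OUTPUT to be a `B₂`-circuit too (in print every string parses as such a circuit; our `Circuit`
  type allows arbitrary gates, so this is the faithful reading, not an extra demand).
* Size. BGI+/GGHRSW measure `|C|`; Arora–Barak (Def. 6.1) count all vertices, inputs included,
  while the tree's `Circuit.size` counts gates only. The classes use `n + C.size` ("inputs +
  gates"), so that `ppolyCircuits κ` is finite up to gate tables and bounds the arity as in print.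
  "Same size" for a pair `C₀ C₁ : Circuit (Fin n)` is `C₀.size = C₁.size` (same `n` by typing).
* Perfect functionality is stated on the support of `obfPMF κ C` ("`Pr[⋯] = 1`" over the
  obfuscator's coins, GGHRSW Def. 1(i)); `preservesFunctionality_iff` is the coin-wise form.
  Approximate-functionality variants (BGI+ §4.3) are deliberately not provided.
* Security parameter. GGHRSW's syntax `iO(λ, C)` is used (BGI+ take `|C|` itself as the security
  parameter and remark that padding `C` to size `k` "can be thought of as increasing the security
  parameter from `|C|` to `k`", §7). The negligible bound is a function of `κ`, uniform over the
  pairs in `𝒞 κ`, with the printed quantifier order `∀ D, ∃ ε, ∀ κ, ∀ (C₀, C₁)`; the ensemble form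
  (for every sequence of admissible pairs the two obfuscation ensembles are
  `IsCompIndistinguishable`) is the proved corollary `IsIndistinguishable.isCompIndistinguishable`.
* Polynomial slowdown is implied in print by "PPT machine"; it is kept as an explicit predicate
  (BGI+ list it among the syntactic requirements, and in our model a class may contain circuits
  with a huge number `n` of idle inputs), in the form `(obf κ C r).size ≤ p(κ + (n + C.size))`.
* Distinguishers. BGI+ Def. 7.1 quantifies over PPT (uniform) machines, GGHRSW Def. 1 over "not
  necessarily uniform" ones; both are provided (`IsIndistinguishable`, matching the tree's
  `IsCompIndistinguishable` whose PPT notion carries `O(log)` bits of advice through the coin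
  budget — see the modelling remark in `Indistinguishability.lean` —, and
  `IsIndistinguishableNonuniform` with polynomial advice). Quantum (post-quantum iO) and
  sub-exponential variants are not provided here.
* NOT here: virtual-black-box obfuscation (BGI+ Def. 2.2, proved impossible there, Thm. 3.8),
  differing-inputs obfuscation (BGI+ Def. 7.3), TM obfuscators (BGI+ Def. 2.1), candidate
  constructions.
* Mathlib has no program obfuscation (searched `bfuscat`, `Obfusc`: nothing); anchors reused:
  `PMF.map`, `PMF.support`, `PMF.uniformOfFintype`, `Computability.encodeNat`/`unaryEncodeNat`,
  `Asymptotics.SuperpolynomialDecay`. Tree anchors: `Circuit`, `B2`, `encodeCircuit`, `RandAlg`,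
  `RandAlg.IsPolyTime`, `uniformBits`, `acceptPMF`, `distAdvantage`, `IsCompIndistinguishable`.

## Status of `IOExist`

`IOExist` (an efficient iO in the sense of `IsIO` exists for the class `ppolyCircuits` of GGHRSW
Def. 2) is an ASSUMPTION, not a theorem in print:
BGI+ prove only that *inefficient* indistinguishability obfuscators exist (Prop. 7.2: output the
lexicographically first equivalent circuit of the same size); GGHRSW give a *candidate* from
candidate multilinear maps; Jain–Lin–Sahai (STOC 2021) construct iO for `P/poly` from
(sub-exponential forms of) well-founded assumptions. It is registered as an open statement
(`[status: open]`), used only as a hypothesis `(h : IOExist)`.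

## References (what was read)

* B. Barak, O. Goldreich, R. Impagliazzo, S. Rudich, A. Sahai, S. Vadhan, K. Yang, *On the
  (im)possibility of obfuscating programs*, J. ACM 59 (2012) Art. 6 (CRYPTO 2001); read in the
  authors' full version of 18 July 2010 (same text): §2.1 (PPT = probabilistic polynomial-time
  Turing machine; circuits with AND/OR/NOT gates), Def. 2.2 (circuit obfuscator), §7, Def. 7.1
  (indistinguishability obfuscator), Prop. 7.2 (inefficient iO exist). Key `BarakEtAl2012`.
* S. Garg, C. Gentry, S. Halevi, M. Raykova, A. Sahai, B. Waters, *Candidate indistinguishability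
  obfuscation and functional encryption for all circuits*, FOCS 2013 (SIAM J. Comput. 45 (2016)),
  §2, Def. 1 (iO for a circuit class), Def. 2 (iO for `P/poly`). Key `GargEtAl2013`. The original
  could not be opened from this host (acquisition request filed); its Def. 1 was checked against
  three verbatim restatements that were read: H. Lin, R. Pass, K. Seth, S. Telang, *Indistinguisha-
  bility obfuscation with non-trivial efficiency* (PKC 2016), Def. 7; P. Ananth, A. Jain, A. Sahai,
  ePrint 2015/730, Def. 1; N. Bitansky, A. Degwekar, V. Vaikuntanathan, SIAM J. Comput. 50 (2021),
  Def. 2.2 (game form). Key `BitanskyDegwekarVaikuntanathan2021`.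
* O. Goldreich, *Foundations of Cryptography I*, CUP 2001, Def. 3.2.2 (the distinguishing
  experiment reused through `Indistinguishability.lean`).
-/

namespace Literature.Computability.Cryptography

open Filter Asymptotics _root_.Computability Complexity QuantumComplexity

/-! ### Sized circuits, their code, circuit classes -/

/-- A *sized circuit*: a number `n` of Boolean inputs together with a single-output Boolean
circuit on the inputs `Fin n` (the tree's straight-line programs `Circuit`). This is the input
(and output) type of an obfuscator. [cite: BarakEtAl2012, §2.1 and Def. 2.2] -/
abbrev SizedCircuit : Type := Σ n : ℕ, Circuit (Fin n)

/-- The Boolean code of a sized circuit: `⟨n, C⟩ ↦ ⟨bin n, encodeCircuit C⟩` (Arora–Barak-style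
self-delimiting pairing `boolPair` of the binary arity and the explicit gate-list code of
`Forrelation.lean`). This is "the string `O(C)`" handed to distinguishers.
[cite: AroraBarak2009, §0.1 and §6.1] -/
def encodeSizedCircuit (C : SizedCircuit) : List Bool :=
  boolPair (encodeNat C.1) (encodeCircuit C.2)

/-- The code of a sized circuit determines it (injectivity of `boolPair`, of the binary code of
naturals and of `encodeCircuit`). [cite: AroraBarak2009, §0.1 and §6.1] -/
theorem encodeSizedCircuit_injective : Function.Injective encodeSizedCircuit := by
  rintro ⟨n, C⟩ ⟨n', C'⟩ h
  have h' : boolPair (encodeNat n) (encodeCircuit C) =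
      boolPair (encodeNat n') (encodeCircuit C') := h
  obtain ⟨h1, h2⟩ := QuantumComplexity.boolPair_inj.1 h'
  obtain rfl : n = n' := QuantumComplexity.encodeNat_injective h1
  obtain rfl : C = C' := QuantumComplexity.encodeCircuit_injective h2
  rfl

/-- `sizeBoundedCircuits s κ`: the class of `B₂`-circuits (fan-in `≤ 2`) whose size, counted
with the input vertices as in Arora–Barak's Def. 6.1 (`n` inputs `+` number of gates), is at most
`s κ` at security parameter `κ`. A circuit class `{𝒞_λ}` in the sense of GGHRSW, Def. 1.
[cite: GargEtAl2013, Def. 1 and Def. 2] -/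
def sizeBoundedCircuits (s : ℕ → ℕ) (κ : ℕ) : Set SizedCircuit :=
  {C | C.2.IsOver B2 ∧ C.1 + C.2.size ≤ s κ}

/-- `ppolyCircuits κ`: all (`B₂`-)circuits of size at most `κ` — the class `𝒞_λ` of GGHRSW's
Def. 2 ("indistinguishability obfuscator for `P/poly`"). [cite: GargEtAl2013, Def. 2] -/
def ppolyCircuits : ℕ → Set SizedCircuit :=
  sizeBoundedCircuits id

/-- Membership in `sizeBoundedCircuits` unfolded. [cite: GargEtAl2013, Def. 1 and Def. 2] -/
@[simp] theorem mem_sizeBoundedCircuits_iff (s : ℕ → ℕ) (κ n : ℕ) (C : Circuit (Fin n)) :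
    (⟨n, C⟩ : SizedCircuit) ∈ sizeBoundedCircuits s κ ↔ C.IsOver B2 ∧ n + C.size ≤ s κ :=
  Iff.rfl

/-- Membership in `ppolyCircuits` unfolded: `B₂`-circuits with `n + #gates ≤ κ`.
[cite: GargEtAl2013, Def. 2] -/
@[simp] theorem mem_ppolyCircuits_iff (κ n : ℕ) (C : Circuit (Fin n)) :
    (⟨n, C⟩ : SizedCircuit) ∈ ppolyCircuits κ ↔ C.IsOver B2 ∧ n + C.size ≤ κ :=
  Iff.rfl

/-- The size-bounded classes are monotone in the size bound.
[cite: GargEtAl2013, Def. 1 and Def. 2] -/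
theorem sizeBoundedCircuits_mono {s s' : ℕ → ℕ} (h : ∀ κ, s κ ≤ s' κ) (κ : ℕ) :
    sizeBoundedCircuits s κ ⊆ sizeBoundedCircuits s' κ :=
  fun _ hC => ⟨hC.1, hC.2.trans (h κ)⟩

/-! ### Obfuscators: syntax -/

/-- A (candidate) *circuit obfuscator* in security-parameter syntax: a probabilistic algorithm
which, on the security parameter `κ` (the papers' `λ`, given in unary), a circuit `C` on `n`
inputs and a coin string `r`, outputs a circuit `obf κ C r` ("`iO(λ, C; r)`") on the same `n`
inputs, together with its coin budget `coinLen m` on inputs of encoded length `m` (as for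
`RandAlg`). No requirement is imposed here: efficiency, functionality, slowdown and security are
the predicates `IsEfficient`, `PreservesFunctionality`, `HasPolySlowdown`, `IsIndistinguishable`
below (BGI+ Def. 2.2 / 7.1 "a probabilistic algorithm `O`"; GGHRSW Def. 1 "`iO(λ, C)`").
[cite: GargEtAl2013, Def. 1] -/
structure CircuitObfuscator where
  /-- `obf κ C r`: the obfuscation of `C` at security parameter `κ` with coins `r`. -/
  obf : ℕ → ∀ {n : ℕ}, Circuit (Fin n) → List Bool → Circuit (Fin n)
  /-- The number of coins used on inputs `(1^κ, ⟨n, C⟩)` of encoded length `m`. -/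
  coinLen : ℕ → ℕ

namespace CircuitObfuscator

variable (O : CircuitObfuscator)

/-- The input encoding of an obfuscator: `(κ, ⟨n, C⟩) ↦ ⟨1^κ, ⟨bin n, encodeCircuit C⟩⟩`
(security parameter in unary, as for all adversaries and algorithms of this topic).
[cite: GargEtAl2013, Def. 1] -/
def encodeInput (p : ℕ × SizedCircuit) : List Bool :=
  boolPair (unaryEncodeNat p.1) (encodeSizedCircuit p.2)

/-- The obfuscator as a randomized algorithm on sized circuits
(`run (κ, ⟨n, C⟩) r = ⟨n, obf κ C r⟩`, same coin budget). [cite: GargEtAl2013, Def. 1] -/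
def toRandAlg : RandAlg (ℕ × SizedCircuit) SizedCircuit where
  run p r := ⟨p.2.1, O.obf p.1 p.2.2 r⟩
  coinLen := O.coinLen

/-- `O.coins κ C`: the number of coins the obfuscator tosses on `(1^κ, C)`, i.e. its coin budget
at the encoded input length. [cite: GargEtAl2013, Def. 1] -/
def coins (κ : ℕ) {n : ℕ} (C : Circuit (Fin n)) : ℕ :=
  O.coinLen (encodeInput (κ, ⟨n, C⟩)).length

/-- `O.obfPMF κ C`: the distribution `iO(λ, C)` of the obfuscated circuit — the push-forward of
uniform coins `U_{coins κ C}` under `r ↦ obf κ C r`. [cite: GargEtAl2013, Def. 1] -/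
noncomputable def obfPMF (κ : ℕ) {n : ℕ} (C : Circuit (Fin n)) : PMF (Circuit (Fin n)) :=
  (uniformBits (O.coins κ C)).map (O.obf κ C)

/-- `O.obfCodePMF κ C`: the distribution of the CODE `encodeSizedCircuit ⟨n, iO(λ, C)⟩` of the
obfuscated circuit (what a distinguisher reads). [cite: GargEtAl2013, Def. 1] -/
noncomputable def obfCodePMF (κ : ℕ) {n : ℕ} (C : Circuit (Fin n)) : PMF (List Bool) :=
  (O.obfPMF κ C).map fun C' => encodeSizedCircuit ⟨n, C'⟩

/-! ### The four requirements -/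

/-- `O.IsEfficient`: the obfuscator is a (uniform) probabilistic polynomial-time algorithm —
`(1^κ, ⟨n, C⟩; r) ↦ ⟨n, obf κ C r⟩` is polynomial-time computable on the codes and the coin budget
is polynomially bounded (`RandAlg.IsPolyTime`). BGI+: "we say that `O` is efficient if it runs in
polynomial time"; GGHRSW: "a uniform PPT machine `iO`". (A predicate on the obfuscator, not a
named fact.) [cite: BarakEtAl2012, Def. 2.2] -/
def IsEfficient (Obf : CircuitObfuscator) : Prop :=
  Obf.toRandAlg.IsPolyTime encodeInput encodeSizedCircuit

/-- `O.PreservesFunctionality 𝒞` (PERFECT functionality / completeness): for every security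
parameter `κ` and every circuit `C` of the class `𝒞 κ`, EVERY outcome `C'` of `iO(κ, C)` (every
circuit in the support of `obfPMF κ C`, i.e. "with probability `1`" over the obfuscator's coins)
is a `B₂`-circuit computing the same function: `C'.eval = C.eval`. BGI+ Def. 2.2: "the string
`O(C)` describes a circuit that computes the same function as `C`"; GGHRSW Def. 1(i):
`Pr[C'(x) = C(x) : C' ← iO(λ, C)] = 1`. Coin-wise form: `preservesFunctionality_iff`.
[cite: GargEtAl2013, Def. 1] -/
def PreservesFunctionality (𝒞 : ℕ → Set SizedCircuit) : Prop :=
  ∀ (κ n : ℕ) (C : Circuit (Fin n)), (⟨n, C⟩ : SizedCircuit) ∈ 𝒞 κ →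
    ∀ C' ∈ (O.obfPMF κ C).support, C'.IsOver B2 ∧ ∀ x, C'.eval x = C.eval x

/-- `O.HasPolySlowdown 𝒞` (polynomial slowdown): there is a polynomial `p` with
`|iO(κ, C)| ≤ p(κ + |C|)` for every `C` in the class and every outcome, sizes counted as
`n + #gates` on the input side and `#gates` on the output side (same `n`). BGI+ Def. 2.2:
"there is a polynomial `p` such that for every circuit `C`, `|O(C)| ≤ p(|C|)`" (there `|C|` is also
the security parameter). [cite: BarakEtAl2012, Def. 2.2] -/
def HasPolySlowdown (𝒞 : ℕ → Set SizedCircuit) : Prop :=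
  ∃ p : Polynomial ℕ, ∀ (κ n : ℕ) (C : Circuit (Fin n)), (⟨n, C⟩ : SizedCircuit) ∈ 𝒞 κ →
    ∀ C' ∈ (O.obfPMF κ C).support, C'.size ≤ p.eval (κ + (n + C.size))

/-- `O.ioAdvantage D κ C₀ C₁ = |Pr[D(1^κ, iO(κ, C₀)) = 1] − Pr[D(1^κ, iO(κ, C₁)) = 1]|`, the
advantage of the distinguisher `D` (run as in `acceptPMF`: input `⟨1^κ, code⟩`, fresh coins)
between obfuscations of `C₀` and of `C₁`. [cite: BarakEtAl2012, Def. 7.1] -/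
noncomputable def ioAdvantage (D : RandAlg (List Bool) Bool) (κ : ℕ) {n : ℕ}
    (C₀ C₁ : Circuit (Fin n)) : ℝ :=
  |(acceptPMF D κ (O.obfCodePMF κ C₀) true).toReal -
    (acceptPMF D κ (O.obfCodePMF κ C₁) true).toReal|

/-- `O.ioAdvantageAdv D a κ C₀ C₁`: the same advantage for a distinguisher with advice string
`a κ` (run as in `acceptPMFAdv`). [cite: GargEtAl2013, Def. 1] -/
noncomputable def ioAdvantageAdv (D : RandAlg (List Bool) Bool) (a : ℕ → List Bool) (κ : ℕ)
    {n : ℕ} (C₀ C₁ : Circuit (Fin n)) : ℝ :=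
  |(acceptPMFAdv D a κ (O.obfCodePMF κ C₀) true).toReal -
    (acceptPMFAdv D a κ (O.obfCodePMF κ C₁) true).toReal|

/-- `O.IsIndistinguishable 𝒞` (indistinguishability, uniform distinguishers): for every PPT
distinguisher `D` there is a negligible `ε` (superpolynomial decay in `κ`) such that for every
security parameter `κ` and every two circuits `C₀, C₁` of the class `𝒞 κ` that have the same size
and compute the same function, `|Pr[D(1^κ, iO(κ, C₀)) = 1] − Pr[D(1^κ, iO(κ, C₁)) = 1]| ≤ ε κ`.
BGI+ Def. 7.1 ("for any PPT `A`, there is a negligible `α` such that for any two circuits that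
compute the same function and are of the same size `k` … `≤ α(k)`"), in the security-parameter
syntax of GGHRSW Def. 1(ii); the distinguishers are exactly those of `IsCompIndistinguishable`
(ensemble form: `IsIndistinguishable.isCompIndistinguishable`). [cite: BarakEtAl2012, Def. 7.1] -/
def IsIndistinguishable (𝒞 : ℕ → Set SizedCircuit) : Prop :=
  ∀ D : RandAlg (List Bool) Bool, IsPPT D encodeBool →
    ∃ ε : ℕ → ℝ, SuperpolynomialDecay atTop (fun k : ℕ => (k : ℝ)) ε ∧
      ∀ (κ n : ℕ) (C₀ C₁ : Circuit (Fin n)), (⟨n, C₀⟩ : SizedCircuit) ∈ 𝒞 κ →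
        (⟨n, C₁⟩ : SizedCircuit) ∈ 𝒞 κ → C₀.size = C₁.size → (∀ x, C₀.eval x = C₁.eval x) →
          O.ioAdvantage D κ C₀ C₁ ≤ ε κ

/-- `O.IsIndistinguishableNonuniform 𝒞`: the same requirement against non-uniform polynomial-time
distinguishers, rendered as PPT distinguishers with polynomial-length advice (the convention of
`IsCompIndistinguishableNonuniform` / `IsOneWayNonuniform`). GGHRSW Def. 1(ii): "for any (not
necessarily uniform) PPT distinguisher `D`, there exists a negligible function `α` such that … for
all security parameters `λ`, for all pairs of circuits `C₀, C₁ ∈ 𝒞_λ`, if `C₀(x) = C₁(x)` for all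
inputs `x`, then `|Pr[D(iO(λ, C₀)) = 1] − Pr[D(iO(λ, C₁)) = 1]| ≤ α(λ)`" (pairs of the same size).
[cite: GargEtAl2013, Def. 1] -/
def IsIndistinguishableNonuniform (𝒞 : ℕ → Set SizedCircuit) : Prop :=
  ∀ D : RandAlg (List Bool) Bool, IsPPT D encodeBool → ∀ a : ℕ → List Bool, IsPolyLength a →
    ∃ ε : ℕ → ℝ, SuperpolynomialDecay atTop (fun k : ℕ => (k : ℝ)) ε ∧
      ∀ (κ n : ℕ) (C₀ C₁ : Circuit (Fin n)), (⟨n, C₀⟩ : SizedCircuit) ∈ 𝒞 κ →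
        (⟨n, C₁⟩ : SizedCircuit) ∈ 𝒞 κ → C₀.size = C₁.size → (∀ x, C₀.eval x = C₁.eval x) →
          O.ioAdvantageAdv D a κ C₀ C₁ ≤ ε κ

end CircuitObfuscator

/-! ### Indistinguishability obfuscators -/

/-- `IsIO 𝒞 O`: `O` is an *indistinguishability obfuscator* for the circuit class `𝒞` — a uniform
PPT algorithm (`isEfficient`) with perfect functionality on `𝒞` (`preserves`), polynomial slowdown
(`slowdown`) and indistinguishability of obfuscations of same-size functionally equivalent circuits
of `𝒞` against PPT distinguishers (`indist`). BGI+ Def. 7.1 (with Def. 2.2 for the syntactic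
requirements) in the security-parameter syntax of GGHRSW Def. 1; the variant with non-uniform
distinguishers is `IsIONonuniform`. [cite: BarakEtAl2012, Def. 7.1] -/
structure IsIO (𝒞 : ℕ → Set SizedCircuit) (O : CircuitObfuscator) : Prop where
  /-- The obfuscator is probabilistic polynomial-time. -/
  isEfficient : O.IsEfficient
  /-- Perfect functionality on the class. -/
  preserves : O.PreservesFunctionality 𝒞
  /-- Polynomial slowdown on the class. -/
  slowdown : O.HasPolySlowdown 𝒞
  /-- Indistinguishability against PPT distinguishers. -/
  indist : O.IsIndistinguishable 𝒞

/-- `IsIONonuniform 𝒞 O`: `O` is an indistinguishability obfuscator for `𝒞` secure against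
non-uniform PPT distinguishers (PPT with polynomial advice) — GGHRSW Def. 1 verbatim ("for any
(not necessarily uniform) PPT distinguisher"). [cite: GargEtAl2013, Def. 1] -/
structure IsIONonuniform (𝒞 : ℕ → Set SizedCircuit) (O : CircuitObfuscator) : Prop where
  /-- The obfuscator is probabilistic polynomial-time. -/
  isEfficient : O.IsEfficient
  /-- Perfect functionality on the class. -/
  preserves : O.PreservesFunctionality 𝒞
  /-- Polynomial slowdown on the class. -/
  slowdown : O.HasPolySlowdown 𝒞
  /-- Indistinguishability against PPT distinguishers with polynomial advice. -/
  indist : O.IsIndistinguishableNonuniform 𝒞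

/-- An *indistinguishability obfuscator for the class `𝒞`*, bundled: a circuit obfuscator
together with the proof that it is an iO for `𝒞` (`IsIO`). Existence is NOT asserted anywhere
(see `IOExist`); routes take `(iO : IndistinguishabilityObfuscator 𝒞)` or
`(O : CircuitObfuscator) (hO : IsIO 𝒞 O)` as hypotheses. [cite: BarakEtAl2012, Def. 7.1] -/
structure IndistinguishabilityObfuscator (𝒞 : ℕ → Set SizedCircuit) extends CircuitObfuscator where
  /-- The bundled obfuscator is an indistinguishability obfuscator for `𝒞`. -/
  isIO : IsIO 𝒞 toCircuitObfuscator

/-- OPEN STATEMENT — `IOExist`: **(efficient) indistinguishability obfuscators for `P/poly`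
exist**, i.e. some uniform PPT circuit obfuscator is an iO in the sense of `IsIO` (BGI+ Def. 7.1:
PPT distinguishers) for the class `ppolyCircuits` of all circuits of size at most the security
parameter (the class of GGHRSW's Def. 2; GGHRSW's own Def. 1–2 ask security against non-uniform
distinguishers, `IsIONonuniform`, which is not weaker). Not a theorem in print: BGI+ prove only
that INEFFICIENT indistinguishability obfuscators exist (Prop. 7.2: output the lexicographically
first circuit of size `|C|` computing the same function) and call constructing efficient ones "very
interesting" (§7); GGHRSW's construction is a *candidate* resting on candidate multilinear maps
(the paper's title); Jain–Lin–Sahai (STOC 2021, key `JainLinSahai2021`) construct iO for `P/poly`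
from the sub-exponential hardness of well-founded assumptions — a conditional theorem. Registered as
an open statement (CONVENTIONS §4), used only as a hypothesis `(h : IOExist)`; not literature debt
awaiting an unconditional discharge. [cite: BarakEtAl2012, Def. 7.1 and Prop. 7.2] [status: open] -/
@[conjecture] def IOExist : Prop :=
  ∃ O : CircuitObfuscator, IsIO ppolyCircuits O

/-! ### API -/

/-- The support of `U_m` is the set of `m`-bit strings. [cite: Goldreich2001, §1.3] -/
theorem mem_support_uniformBits_iff_length {m : ℕ} {s : List Bool} :
    s ∈ (uniformBits m).support ↔ s.length = m := by
  rw [uniformBits, PMF.mem_support_map_iff]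
  constructor
  · rintro ⟨v, -, rfl⟩
    exact v.toList_length
  · intro h
    exact ⟨⟨s, h⟩, PMF.mem_support_uniformOfFintype _, rfl⟩

namespace CircuitObfuscator

variable (O : CircuitObfuscator)

/-- The coin budget of `toRandAlg` is that of the obfuscator (definitional).
[cite: GargEtAl2013, Def. 1] -/
@[simp] theorem toRandAlg_coinLen : O.toRandAlg.coinLen = O.coinLen := rfl

/-- `toRandAlg` runs the obfuscator (definitional). [cite: GargEtAl2013, Def. 1] -/
@[simp] theorem toRandAlg_run (κ n : ℕ) (C : Circuit (Fin n)) (r : List Bool) :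
    O.toRandAlg.run (κ, ⟨n, C⟩) r = ⟨n, O.obf κ C r⟩ := rfl

/-- The outcomes of `iO(κ, C)` are exactly the circuits `obf κ C r` for coin strings `r` of the
prescribed length `coins κ C`. [cite: GargEtAl2013, Def. 1] -/
theorem mem_support_obfPMF_iff {κ n : ℕ} {C C' : Circuit (Fin n)} :
    C' ∈ (O.obfPMF κ C).support ↔ ∃ r, r.length = O.coins κ C ∧ O.obf κ C r = C' := by
  simp only [obfPMF, PMF.mem_support_map_iff, mem_support_uniformBits_iff_length]

/-- Every run on coins of the prescribed length is an outcome of `iO(κ, C)`.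
[cite: GargEtAl2013, Def. 1] -/
theorem obf_mem_support_obfPMF (κ : ℕ) {n : ℕ} (C : Circuit (Fin n)) {r : List Bool}
    (hr : r.length = O.coins κ C) : O.obf κ C r ∈ (O.obfPMF κ C).support :=
  O.mem_support_obfPMF_iff.2 ⟨r, hr, rfl⟩

/-- The outcomes of the coded obfuscation are the codes of the outcomes.
[cite: GargEtAl2013, Def. 1] -/
theorem mem_support_obfCodePMF_iff {κ n : ℕ} {C : Circuit (Fin n)} {w : List Bool} :
    w ∈ (O.obfCodePMF κ C).support ↔
      ∃ C' ∈ (O.obfPMF κ C).support, encodeSizedCircuit ⟨n, C'⟩ = w := by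
  simp only [obfCodePMF, PMF.mem_support_map_iff]

/-- The output law of `toRandAlg` on `(κ, ⟨n, C⟩)` is the obfuscation law `obfPMF κ C` tagged with
the (unchanged) arity `n`. [cite: GargEtAl2013, Def. 1] -/
theorem toRandAlg_outputPMF (κ n : ℕ) (C : Circuit (Fin n)) :
    O.toRandAlg.outputPMF encodeInput (κ, ⟨n, C⟩) = (O.obfPMF κ C).map (Sigma.mk n) := by
  simp only [RandAlg.outputPMF, obfPMF, uniformBits, PMF.map_comp]
  rfl

/-- Perfect functionality, coin-wise: `O` preserves functionality on `𝒞` iff for every `C` in the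
class and EVERY coin string `r` of the prescribed length, `obf κ C r` is a `B₂`-circuit with
`(obf κ C r).eval = C.eval`. [cite: GargEtAl2013, Def. 1] -/
theorem preservesFunctionality_iff (𝒞 : ℕ → Set SizedCircuit) :
    O.PreservesFunctionality 𝒞 ↔
      ∀ (κ n : ℕ) (C : Circuit (Fin n)), (⟨n, C⟩ : SizedCircuit) ∈ 𝒞 κ →
        ∀ r : List Bool, r.length = O.coins κ C →
          (O.obf κ C r).IsOver B2 ∧ ∀ x, (O.obf κ C r).eval x = C.eval x := by
  constructor
  · intro h κ n C hC r hr
    exact h κ n C hC _ (O.obf_mem_support_obfPMF κ C hr)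
  · intro h κ n C hC C' hC'
    obtain ⟨r, hr, rfl⟩ := O.mem_support_obfPMF_iff.1 hC'
    exact h κ n C hC r hr

variable {O}

/-- Perfect functionality at a coin string of the prescribed length: `(obf κ C r)(x) = C(x)` for
all `x`. [cite: GargEtAl2013, Def. 1] -/
theorem PreservesFunctionality.eval_obf {𝒞 : ℕ → Set SizedCircuit} (h : O.PreservesFunctionality 𝒞)
    {κ n : ℕ} {C : Circuit (Fin n)} (hC : (⟨n, C⟩ : SizedCircuit) ∈ 𝒞 κ) {r : List Bool}
    (hr : r.length = O.coins κ C) (x : Fin n → Bool) : (O.obf κ C r).eval x = C.eval x :=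
  ((O.preservesFunctionality_iff 𝒞).1 h κ n C hC r hr).2 x

/-- The obfuscation of a circuit of the class is a `B₂`-circuit (coin string of the prescribed
length). [cite: GargEtAl2013, Def. 1] -/
theorem PreservesFunctionality.isOver_obf {𝒞 : ℕ → Set SizedCircuit}
    (h : O.PreservesFunctionality 𝒞) {κ n : ℕ} {C : Circuit (Fin n)}
    (hC : (⟨n, C⟩ : SizedCircuit) ∈ 𝒞 κ) {r : List Bool} (hr : r.length = O.coins κ C) :
    (O.obf κ C r).IsOver B2 :=
  ((O.preservesFunctionality_iff 𝒞).1 h κ n C hC r hr).1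

/-- Every outcome of `iO(κ, C)` computes the function of `C` (support form).
[cite: GargEtAl2013, Def. 1] -/
theorem PreservesFunctionality.computes {𝒞 : ℕ → Set SizedCircuit}
    (h : O.PreservesFunctionality 𝒞) {κ n : ℕ} {C C' : Circuit (Fin n)}
    (hC : (⟨n, C⟩ : SizedCircuit) ∈ 𝒞 κ) (hC' : C' ∈ (O.obfPMF κ C).support) :
    C'.Computes C.eval :=
  (h κ n C hC C' hC').2

/-- Functionality on a class gives functionality on every subclass. [cite: GargEtAl2013, Def. 1] -/
theorem PreservesFunctionality.anti {𝒞 𝒞' : ℕ → Set SizedCircuit}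
    (h : O.PreservesFunctionality 𝒞) (h' : ∀ κ, 𝒞' κ ⊆ 𝒞 κ) : O.PreservesFunctionality 𝒞' :=
  fun κ n C hC => h κ n C (h' κ hC)

/-- Polynomial slowdown on a class gives it on every subclass. [cite: BarakEtAl2012, Def. 2.2] -/
theorem HasPolySlowdown.anti {𝒞 𝒞' : ℕ → Set SizedCircuit} (h : O.HasPolySlowdown 𝒞)
    (h' : ∀ κ, 𝒞' κ ⊆ 𝒞 κ) : O.HasPolySlowdown 𝒞' := by
  obtain ⟨p, hp⟩ := h
  exact ⟨p, fun κ n C hC => hp κ n C (h' κ hC)⟩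

variable (O)

/-- The iO advantage is the distinguishing advantage (`distAdvantage` of
`Indistinguishability.lean`) at index `κ` between the two (constant) obfuscation ensembles.
[cite: Goldreich2001, Def. 3.2.2] -/
theorem ioAdvantage_eq_distAdvantage (D : RandAlg (List Bool) Bool) (κ : ℕ) {n : ℕ}
    (C₀ C₁ : Circuit (Fin n)) :
    O.ioAdvantage D κ C₀ C₁ =
      distAdvantage D (fun _ => O.obfCodePMF κ C₀) (fun _ => O.obfCodePMF κ C₁) κ :=
  rfl

/-- The iO advantage is nonnegative. [cite: BarakEtAl2012, Def. 7.1] -/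
theorem ioAdvantage_nonneg (D : RandAlg (List Bool) Bool) (κ : ℕ) {n : ℕ}
    (C₀ C₁ : Circuit (Fin n)) : 0 ≤ O.ioAdvantage D κ C₀ C₁ :=
  abs_nonneg _

/-- The iO advantage is at most `1`. [cite: BarakEtAl2012, Def. 7.1] -/
theorem ioAdvantage_le_one (D : RandAlg (List Bool) Bool) (κ : ℕ) {n : ℕ}
    (C₀ C₁ : Circuit (Fin n)) : O.ioAdvantage D κ C₀ C₁ ≤ 1 := by
  rw [ioAdvantage_eq_distAdvantage]
  exact distAdvantage_le_one _ _ _ _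

/-- The iO advantage is symmetric in the two circuits. [cite: BarakEtAl2012, Def. 7.1] -/
theorem ioAdvantage_comm (D : RandAlg (List Bool) Bool) (κ : ℕ) {n : ℕ}
    (C₀ C₁ : Circuit (Fin n)) : O.ioAdvantage D κ C₀ C₁ = O.ioAdvantage D κ C₁ C₀ :=
  abs_sub_comm _ _

/-- The iO advantage between a circuit and itself vanishes. [cite: BarakEtAl2012, Def. 7.1] -/
@[simp] theorem ioAdvantage_self (D : RandAlg (List Bool) Bool) (κ : ℕ) {n : ℕ}
    (C : Circuit (Fin n)) : O.ioAdvantage D κ C C = 0 := by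
  simp [ioAdvantage]

/-- The advised iO advantage is nonnegative. [cite: GargEtAl2013, Def. 1] -/
theorem ioAdvantageAdv_nonneg (D : RandAlg (List Bool) Bool) (a : ℕ → List Bool) (κ : ℕ) {n : ℕ}
    (C₀ C₁ : Circuit (Fin n)) : 0 ≤ O.ioAdvantageAdv D a κ C₀ C₁ :=
  abs_nonneg _

/-- The advised iO advantage is the advised distinguishing advantage `distAdvantageAdv` between the
two constant obfuscation ensembles. [cite: Goldreich2001, Def. 3.2.3] -/
theorem ioAdvantageAdv_eq_distAdvantageAdv (D : RandAlg (List Bool) Bool) (a : ℕ → List Bool)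
    (κ : ℕ) {n : ℕ} (C₀ C₁ : Circuit (Fin n)) :
    O.ioAdvantageAdv D a κ C₀ C₁ =
      distAdvantageAdv D a (fun _ => O.obfCodePMF κ C₀) (fun _ => O.obfCodePMF κ C₁) κ :=
  rfl

variable {O}

/-- Indistinguishability on a class gives it on every subclass. [cite: BarakEtAl2012, Def. 7.1] -/
theorem IsIndistinguishable.anti {𝒞 𝒞' : ℕ → Set SizedCircuit} (h : O.IsIndistinguishable 𝒞)
    (h' : ∀ κ, 𝒞' κ ⊆ 𝒞 κ) : O.IsIndistinguishable 𝒞' := by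
  intro D hD
  obtain ⟨ε, hε, hb⟩ := h D hD
  exact ⟨ε, hε, fun κ n C₀ C₁ h₀ h₁ => hb κ n C₀ C₁ (h' κ h₀) (h' κ h₁)⟩

/-- Non-uniform indistinguishability on a class gives it on every subclass.
[cite: GargEtAl2013, Def. 1] -/
theorem IsIndistinguishableNonuniform.anti {𝒞 𝒞' : ℕ → Set SizedCircuit}
    (h : O.IsIndistinguishableNonuniform 𝒞) (h' : ∀ κ, 𝒞' κ ⊆ 𝒞 κ) :
    O.IsIndistinguishableNonuniform 𝒞' := by
  intro D hD a ha
  obtain ⟨ε, hε, hb⟩ := h D hD a ha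
  exact ⟨ε, hε, fun κ n C₀ C₁ h₀ h₁ => hb κ n C₀ C₁ (h' κ h₀) (h' κ h₁)⟩

/-- **Ensemble form of indistinguishability.** If `O` is indistinguishable on `𝒞`, then for any
two sequences `C₀ κ, C₁ κ : Circuit (Fin (ν κ))` of circuits of the class, of the same size and
computing the same function at every `κ`, the obfuscation ensembles `κ ↦ iO(κ, C₀ κ)` and
`κ ↦ iO(κ, C₁ κ)` (as codes) are computationally indistinguishable in the sense of
`IsCompIndistinguishable` (negligible advantage for every PPT distinguisher): the bound `ε κ`,
uniform over the pairs of `𝒞 κ`, dominates the advantage along the sequence.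
[cite: BarakEtAl2012, Def. 7.1] -/
theorem IsIndistinguishable.isCompIndistinguishable {𝒞 : ℕ → Set SizedCircuit}
    (h : O.IsIndistinguishable 𝒞) {ν : ℕ → ℕ} (C₀ C₁ : ∀ κ, Circuit (Fin (ν κ)))
    (h₀ : ∀ κ, (⟨ν κ, C₀ κ⟩ : SizedCircuit) ∈ 𝒞 κ) (h₁ : ∀ κ, (⟨ν κ, C₁ κ⟩ : SizedCircuit) ∈ 𝒞 κ)
    (hsize : ∀ κ, (C₀ κ).size = (C₁ κ).size) (heq : ∀ κ x, (C₀ κ).eval x = (C₁ κ).eval x) :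
    IsCompIndistinguishable (fun κ => O.obfCodePMF κ (C₀ κ)) (fun κ => O.obfCodePMF κ (C₁ κ)) := by
  intro D hD
  obtain ⟨ε, hε, hb⟩ := h D hD
  refine hε.trans_abs_le fun κ => ?_
  have hκ : distAdvantage D (fun κ => O.obfCodePMF κ (C₀ κ)) (fun κ => O.obfCodePMF κ (C₁ κ)) κ =
      O.ioAdvantage D κ (C₀ κ) (C₁ κ) := rfl
  rw [hκ, abs_of_nonneg (O.ioAdvantage_nonneg D κ _ _)]
  exact (hb κ (ν κ) (C₀ κ) (C₁ κ) (h₀ κ) (h₁ κ) (hsize κ) (heq κ)).trans (le_abs_self _)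

/-- Ensemble form of non-uniform indistinguishability: obfuscations of two admissible sequences are
`IsCompIndistinguishableNonuniform`. [cite: GargEtAl2013, Def. 1] -/
theorem IsIndistinguishableNonuniform.isCompIndistinguishableNonuniform {𝒞 : ℕ → Set SizedCircuit}
    (h : O.IsIndistinguishableNonuniform 𝒞) {ν : ℕ → ℕ} (C₀ C₁ : ∀ κ, Circuit (Fin (ν κ)))
    (h₀ : ∀ κ, (⟨ν κ, C₀ κ⟩ : SizedCircuit) ∈ 𝒞 κ) (h₁ : ∀ κ, (⟨ν κ, C₁ κ⟩ : SizedCircuit) ∈ 𝒞 κ)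
    (hsize : ∀ κ, (C₀ κ).size = (C₁ κ).size) (heq : ∀ κ x, (C₀ κ).eval x = (C₁ κ).eval x) :
    IsCompIndistinguishableNonuniform (fun κ => O.obfCodePMF κ (C₀ κ))
      (fun κ => O.obfCodePMF κ (C₁ κ)) := by
  intro D hD a ha
  obtain ⟨ε, hε, hb⟩ := h D hD a ha
  refine hε.trans_abs_le fun κ => ?_
  have hκ : distAdvantageAdv D a (fun κ => O.obfCodePMF κ (C₀ κ))
      (fun κ => O.obfCodePMF κ (C₁ κ)) κ = O.ioAdvantageAdv D a κ (C₀ κ) (C₁ κ) := rfl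
  rw [hκ, abs_of_nonneg (O.ioAdvantageAdv_nonneg D a κ _ _)]
  exact (hb κ (ν κ) (C₀ κ) (C₁ κ) (h₀ κ) (h₁ κ) (hsize κ) (heq κ)).trans (le_abs_self _)

end CircuitObfuscator

/-- An iO for a class is an iO for every subclass (all four requirements are antitone in the
class). [cite: GargEtAl2013, Def. 1] -/
theorem IsIO.anti {𝒞 𝒞' : ℕ → Set SizedCircuit} {O : CircuitObfuscator} (h : IsIO 𝒞 O)
    (h' : ∀ κ, 𝒞' κ ⊆ 𝒞 κ) : IsIO 𝒞' O :=
  ⟨h.isEfficient, h.preserves.anti h', h.slowdown.anti h', h.indist.anti h'⟩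

/-- A non-uniformly secure iO for a class is one for every subclass. [cite: GargEtAl2013, Def. 1] -/
theorem IsIONonuniform.anti {𝒞 𝒞' : ℕ → Set SizedCircuit} {O : CircuitObfuscator}
    (h : IsIONonuniform 𝒞 O) (h' : ∀ κ, 𝒞' κ ⊆ 𝒞 κ) : IsIONonuniform 𝒞' O :=
  ⟨h.isEfficient, h.preserves.anti h', h.slowdown.anti h', h.indist.anti h'⟩

/-- Perfect correctness of a bundled iO, coin-wise: `(iO(κ, C; r))(x) = C(x)`.
[cite: GargEtAl2013, Def. 1] -/
theorem IndistinguishabilityObfuscator.eval_obf {𝒞 : ℕ → Set SizedCircuit}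
    (iO : IndistinguishabilityObfuscator 𝒞) {κ n : ℕ} {C : Circuit (Fin n)}
    (hC : (⟨n, C⟩ : SizedCircuit) ∈ 𝒞 κ) {r : List Bool} (hr : r.length = iO.coins κ C)
    (x : Fin n → Bool) : (iO.obf κ C r).eval x = C.eval x :=
  iO.isIO.preserves.eval_obf hC hr x

/-- `IOExist` is the nonemptiness of the bundled type of iO's for `P/poly`.
[cite: GargEtAl2013, Def. 2] -/
theorem ioExist_iff_nonempty : IOExist ↔ Nonempty (IndistinguishabilityObfuscator ppolyCircuits) :=
  ⟨fun ⟨O, h⟩ => ⟨⟨O, h⟩⟩, fun ⟨iO⟩ => ⟨iO.toCircuitObfuscator, iO.isIO⟩⟩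

/-- An iO for `P/poly` is an iO for every class of polynomially size-bounded circuits contained in
it, e.g. `sizeBoundedCircuits s` with `s ≤ id`. [cite: GargEtAl2013, Def. 2] -/
theorem IsIO.of_ppoly {O : CircuitObfuscator} (h : IsIO ppolyCircuits O) {s : ℕ → ℕ}
    (hs : ∀ κ, s κ ≤ κ) : IsIO (sizeBoundedCircuits s) O :=
  h.anti fun κ => sizeBoundedCircuits_mono hs κ

end Literature.Computability.Cryptography
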